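import Mathlib
import Summits.ResolutionOfSingularities.ResolutionOfSingularities.Theorems.WeightedInvariantLocalWeightedDropTOT2CurveConflictDivTwo

/-!
# `LocalWeightedDrop`, NC count game — TOT2-LINE piece S-CRV (v1.3 (P3)/(B2)): the COORDINATE SWAP `u₁ ↔ u₂` of labels — `u₂`-graphs and the
# `u₂`-chart as conjugates of `u₁`-graphs and the `u₁`-chart

[OURS · L1 W4.3 · chain w43, engine crux `LocalWeightedDrop` stmt-ResolutionOfSingularities-8899; piece S-CRV / (P3) = res-type-088; `--supports 8899 --as helper`,
counted 0; definition-free; nothing here is a statement of any manuscript; AI-written (gate-accepted = sorry-free with standard axioms, not refereed).]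

The conflict budget must charge top-locus branches tangent to `V(u₁)` (`u₂`-graphs, design note ADDENDUM v2.1 term `T₁`; kernel example
`…TOT2CurveConflictBirthPointExample`).  `PolyDescent` only speaks of graphs over `u₁`; a `u₂`-graph of `A` is a `u₁`-graph of the SWAPPED label
`j ↦ A_j(u₂, u₁)`.  This file is the plumbing that transports the table F1–F7 through the swap `subst ![X 1, X 0]`:
* `coeff_subst_swap`, `subst_swap_subst_swap` — coefficients, involutivity; `order_subst_swap`;
* `blowTwo_eq_swap_blowOne_swap`, `divTwo_eq_swap_divOne_swap` (and the `T` versions `blowTwoT_eq`, `divTwoT_eq`) — the `u₂`-chart / the `u₂`-curve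
  move are the `u₁`-chart / `u₁`-curve move of the swapped label, swapped back;
* `isPosT_swap_iff`, `isPermissibleTwoT_swap_iff`, `isPermissibleOneT_swap_iff` — positions and axis permissibility under the swap.
-/

set_option linter.dupNamespace false -- mandated namespace of this single-conjunct summit

noncomputable section

namespace Summit.ResolutionOfSingularities.ResolutionOfSingularities.Theorems

namespace TOT2Curve

open MvPowerSeries PolyDescent MonicDescent WildMonic Literature.AlgebraicGeometry.Resolution Literature.RingTheory.TwoVariableSeries

variable {k : Type} [Field k] {d : ℕ}

/-! ## The swap substitution -/

/-- The swap family has zero constant terms. -/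
theorem constantCoeff_swapFamily : ∀ i, constantCoeff (![X 1, X 0] i : MvPowerSeries (Fin 2) k) = 0 := by
  intro i
  fin_cases i
  · exact constantCoeff_X 1
  · exact constantCoeff_X 0

/-- The swap family is substitutable. -/
theorem hasSubst_swap : HasSubst (![X 1, X 0] : Fin 2 → MvPowerSeries (Fin 2) k) :=
  hasSubst_of_constantCoeff_zero constantCoeff_swapFamily

/-- COEFFICIENTS UNDER THE SWAP: `coeff e (F(u₂,u₁)) = coeff (e₁, e₀) F`. -/
theorem coeff_subst_swap (F : MvPowerSeries (Fin 2) k) (e : Fin 2 →₀ ℕ) :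
    coeff e (subst (![X 1, X 0] : Fin 2 → MvPowerSeries (Fin 2) k) F) = coeff (Finsupp.single 0 (e 1) + Finsupp.single 1 (e 0)) F := by
  classical
  rw [coeff_subst hasSubst_swap]
  have hprod : ∀ d : Fin 2 →₀ ℕ, (d.prod fun s m => ((![X 1, X 0] : Fin 2 → MvPowerSeries (Fin 2) k) s) ^ m) =
      monomial (Finsupp.single 0 (d 1) + Finsupp.single 1 (d 0)) 1 := by
    intro d
    rw [Finsupp.prod_fintype _ _ (fun i => pow_zero _), Fin.prod_univ_two]
    show (X 1 : MvPowerSeries (Fin 2) k) ^ d 0 * X 0 ^ d 1 = _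
    rw [X_pow_eq, X_pow_eq, monomial_mul_monomial, one_mul, add_comm]
  simp_rw [hprod, coeff_monomial]
  rw [finsum_eq_single _ (Finsupp.single 0 (e 1) + Finsupp.single 1 (e 0))]
  · rw [if_pos, smul_eq_mul, mul_one]
    refine finsupp_fin2_ext ?_ ?_
    · simp only [Finsupp.add_apply, Finsupp.single_apply]; simp
    · simp only [Finsupp.add_apply, Finsupp.single_apply]; simp
  · intro d hne
    rw [if_neg, smul_zero]
    intro hde
    apply hne
    have h0 := congrArg (fun P => P 0) hde
    have h1 := congrArg (fun P => P 1) hde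
    simp only [Finsupp.add_apply, Finsupp.single_apply] at h0 h1
    simp at h0 h1
    refine finsupp_fin2_ext ?_ ?_
    · simp only [Finsupp.add_apply, Finsupp.single_apply]; simp; omega
    · simp only [Finsupp.add_apply, Finsupp.single_apply]; simp; omega

/-- The swap is an involution. -/
theorem subst_swap_subst_swap (F : MvPowerSeries (Fin 2) k) :
    subst (![X 1, X 0] : Fin 2 → MvPowerSeries (Fin 2) k) (subst (![X 1, X 0] : Fin 2 → MvPowerSeries (Fin 2) k) F) = F := by
  ext e
  rw [coeff_subst_swap, coeff_subst_swap]
  congr 2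
  refine finsupp_fin2_ext ?_ ?_
  · simp only [Finsupp.add_apply, Finsupp.single_apply]; simp
  · simp only [Finsupp.add_apply, Finsupp.single_apply]; simp

/-- The swap preserves the order (total degree is symmetric). -/
theorem order_subst_swap (F : MvPowerSeries (Fin 2) k) :
    (subst (![X 1, X 0] : Fin 2 → MvPowerSeries (Fin 2) k) F).order = F.order := by
  have key : ∀ G : MvPowerSeries (Fin 2) k, G.order ≤ (subst (![X 1, X 0] : Fin 2 → MvPowerSeries (Fin 2) k) G).order := by
    intro G
    apply le_order
    intro e he
    rw [coeff_subst_swap]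
    apply coeff_of_lt_order
    refine lt_of_eq_of_lt ?_ he
    norm_cast
    rw [Finsupp.degree_eq_sum, Finsupp.degree_eq_sum, Fin.sum_univ_two, Fin.sum_univ_two]
    simp only [Finsupp.add_apply, Finsupp.single_apply]
    simp [add_comm]
  refine le_antisymm ?_ (key F)
  have h := key (subst (![X 1, X 0] : Fin 2 → MvPowerSeries (Fin 2) k) F)
  rwa [subst_swap_subst_swap] at h

/-! ## The `u₂`-chart and the `u₂`-curve move as conjugates -/

/-- `blowTwo` is `blowOne` of the swapped series, swapped back. -/
theorem blowTwo_eq_swap_blowOne_swap (c : ℕ) (F : MvPowerSeries (Fin 2) k) :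
    blowTwo c F = subst (![X 1, X 0] : Fin 2 → MvPowerSeries (Fin 2) k)
      (blowOne c (subst (![X 1, X 0] : Fin 2 → MvPowerSeries (Fin 2) k) F)) := by
  ext e
  rw [coeff_blowTwo, coeff_subst_swap, coeff_blowOne]
  simp only [Finsupp.add_apply, Finsupp.single_apply, Fin.isValue, ↓reduceIte, Fin.one_eq_zero_iff, OfNat.ofNat_ne_one,
    Fin.zero_eq_one_iff, zero_add, add_zero]
  split_ifs with h
  · rw [coeff_subst_swap]
    congr 2
    refine finsupp_fin2_ext ?_ ?_
    · simp only [Finsupp.add_apply, Finsupp.single_apply]; simp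
    · simp only [Finsupp.add_apply, Finsupp.single_apply]; simp
  · rfl

/-- `divTwo` is `divOne` of the swapped series, swapped back. -/
theorem divTwo_eq_swap_divOne_swap (c : ℕ) (F : MvPowerSeries (Fin 2) k) :
    divTwo c F = subst (![X 1, X 0] : Fin 2 → MvPowerSeries (Fin 2) k)
      (divOne c (subst (![X 1, X 0] : Fin 2 → MvPowerSeries (Fin 2) k) F)) := by
  ext e
  rw [coeff_divTwo, coeff_subst_swap, coeff_divOne, coeff_subst_swap]
  congr 2
  refine finsupp_fin2_ext ?_ ?_
  · simp only [Finsupp.add_apply, Finsupp.single_apply]; simp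
  · simp only [Finsupp.add_apply, Finsupp.single_apply]; simp

/-- Slotwise: `blowTwoT d A` is the swap of `blowOneT d` of the swapped label. -/
theorem blowTwoT_eq_swap (A : Fin d → MvPowerSeries (Fin 2) k) :
    blowTwoT d A = fun j => subst (![X 1, X 0] : Fin 2 → MvPowerSeries (Fin 2) k)
      (blowOneT d (fun i => subst (![X 1, X 0] : Fin 2 → MvPowerSeries (Fin 2) k) (A i)) j) := by
  funext j
  exact blowTwo_eq_swap_blowOne_swap _ _

/-- Slotwise: `divTwoT d A` is the swap of `divOneT d` of the swapped label. -/
theorem divTwoT_eq_swap (A : Fin d → MvPowerSeries (Fin 2) k) :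
    divTwoT d A = fun j => subst (![X 1, X 0] : Fin 2 → MvPowerSeries (Fin 2) k)
      (divOneT d (fun i => subst (![X 1, X 0] : Fin 2 → MvPowerSeries (Fin 2) k) (A i)) j) := by
  funext j
  exact divTwo_eq_swap_divOne_swap _ _

/-! ## Positions and axis permissibility under the swap -/

/-- Positions are swap-invariant. -/
theorem isPosT_swap_iff (A : Fin d → MvPowerSeries (Fin 2) k) :
    IsPosT d (fun j => subst (![X 1, X 0] : Fin 2 → MvPowerSeries (Fin 2) k) (A j)) ↔ IsPosT d A := by
  unfold IsPosT
  simp_rw [order_subst_swap]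

/-- `V(y,u₂)` is permissible for the swapped label iff `V(y,u₁)` is permissible for the label. -/
theorem isPermissibleTwoT_swap_iff (A : Fin d → MvPowerSeries (Fin 2) k) :
    IsPermissibleTwoT d (fun j => subst (![X 1, X 0] : Fin 2 → MvPowerSeries (Fin 2) k) (A j)) ↔ IsPermissibleOneT d A := by
  constructor
  · intro h j e he
    have hidx : (Finsupp.single (0 : Fin 2) ((Finsupp.single (0 : Fin 2) (e 1) + Finsupp.single 1 (e 0) : Fin 2 →₀ ℕ) 1) +
        Finsupp.single 1 ((Finsupp.single (0 : Fin 2) (e 1) + Finsupp.single 1 (e 0) : Fin 2 →₀ ℕ) 0) : Fin 2 →₀ ℕ) = e :=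
      finsupp_fin2_ext (by simp only [Finsupp.add_apply, Finsupp.single_apply]; simp)
        (by simp only [Finsupp.add_apply, Finsupp.single_apply]; simp)
    have h' := h j (Finsupp.single 0 (e 1) + Finsupp.single 1 (e 0)) (by rw [coeff_subst_swap, hidx]; exact he)
    simpa using h'
  · intro h j e he
    rw [coeff_subst_swap] at he
    have h' := h j _ he
    simpa using h'

/-- `V(y,u₁)` is permissible for the swapped label iff `V(y,u₂)` is permissible for the label. -/
theorem isPermissibleOneT_swap_iff (A : Fin d → MvPowerSeries (Fin 2) k) :
    IsPermissibleOneT d (fun j => subst (![X 1, X 0] : Fin 2 → MvPowerSeries (Fin 2) k) (A j)) ↔ IsPermissibleTwoT d A := by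
  constructor
  · intro h j e he
    have hidx : (Finsupp.single (0 : Fin 2) ((Finsupp.single (0 : Fin 2) (e 1) + Finsupp.single 1 (e 0) : Fin 2 →₀ ℕ) 1) +
        Finsupp.single 1 ((Finsupp.single (0 : Fin 2) (e 1) + Finsupp.single 1 (e 0) : Fin 2 →₀ ℕ) 0) : Fin 2 →₀ ℕ) = e :=
      finsupp_fin2_ext (by simp only [Finsupp.add_apply, Finsupp.single_apply]; simp)
        (by simp only [Finsupp.add_apply, Finsupp.single_apply]; simp)
    have h' := h j (Finsupp.single 0 (e 1) + Finsupp.single 1 (e 0)) (by rw [coeff_subst_swap, hidx]; exact he)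
    simpa using h'
  · intro h j e he
    rw [coeff_subst_swap] at he
    have h' := h j _ he
    simpa using h'

end TOT2Curve

end Summit.ResolutionOfSingularities.ResolutionOfSingularities.Theorems

end
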